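import Summits.KontsevichZagierPeriods.KontsevichZagierPeriods.Theorems.LinRedNormalFormArrangementNormalFormSeparateThreeHIFixed
import Summits.KontsevichZagierPeriods.KontsevichZagierPeriods.Theorems.LinRedNormalFormArrangementNormalFormSeparateThreeHIFibres

/-!
# The column lemma over base points with a non-degenerate closed fibre

(Line `janus-bands`, crux `ArrangementNormalForm`, stub `stub_separateThreeZero`, part `HIColumnN`
of the termwise numerator split `separateThree_hI` under the rim condition.)

The COLUMN BOUND at a base point `v₀`: the fibre integrals `FI i v` of the `i`-th
absolute Taylor piece over base points `v` near `v₀` are at most `C · (FF v + ‖v − v₀‖⁻¹ + 1)`.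
This part proves it when the closed vertical fibre of the cell over `v₀` contains two points
`wa < wb` (no rim condition needed): by the column lemma all nearby fibres contain a fixed interval;
if `n = 0`, or if `n ≠ 0` and the closed fibre stays away from the pole plane, norm equivalence on
the fixed interval dominates every piece (`colBound_of_fixed`, part `HIFixed`); if `n ≠ 0` and the
closed fibre touches the pole plane, the nearby fibres are thick and the one-dimensional brick
applies (`colBound_of_touch`, registered as `separateThree_columnN`).
-/

noncomputable section

open Set MeasureTheory Filter Topology
open scoped ENNReal

namespace Summit.KontsevichZagierPeriods.ArrangementNormalForm.JanusBands

namespace SepThree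

section ColumnN

variable {J m : ℕ} (g : Fin J → Con) (κ : Fin m → Fin 2 → ℝ) (μ : Fin m → ℝ) (e : Fin m → ℕ)
  (N : ℕ) (q : ℕ → MvPolynomial (Fin 2) ℝ) (n : ℕ) (i : ℕ) (v₀ : Fin 2 → ℝ)

/-- A fibrewise domination by the integrand gives the column bound. -/
theorem colBound_of_FF {δ : ℝ} (hδ : 0 < δ) {C : ℝ≥0∞} (hC : C ≠ ∞)
    (h : ∀ v : Fin 2 → ℝ, ‖v - v₀‖ < δ → FI κ μ e q n (Om3 g) i v ≤ C * FF κ μ e N q n (Om3 g) v) :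
    ∃ δ > 0, ∃ C : ℝ≥0∞, C ≠ ∞ ∧ ∀ v : Fin 2 → ℝ, v ≠ v₀ → ‖v - v₀‖ < δ →
      FI κ μ e q n (Om3 g) i v ≤ C * (FF κ μ e N q n (Om3 g) v + ENNReal.ofReal ‖v - v₀‖⁻¹ + 1) :=
  ⟨δ, hδ, C, hC, fun v _ hv => (h v hv).trans (by gcongr; rw [add_assoc]; exact le_self_add)⟩

/-- A uniform bound of the fibre integrals gives the column bound. -/
theorem colBound_of_const {δ : ℝ} (hδ : 0 < δ) {K : ℝ}
    (h : ∀ v : Fin 2 → ℝ, ‖v - v₀‖ < δ → FI κ μ e q n (Om3 g) i v ≤ ENNReal.ofReal K) :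
    ∃ δ > 0, ∃ C : ℝ≥0∞, C ≠ ∞ ∧ ∀ v : Fin 2 → ℝ, v ≠ v₀ → ‖v - v₀‖ < δ →
      FI κ μ e q n (Om3 g) i v ≤ C * (FF κ μ e N q n (Om3 g) v + ENNReal.ofReal ‖v - v₀‖⁻¹ + 1) :=
  ⟨δ, hδ, ENNReal.ofReal K, ENNReal.ofReal_ne_top, fun v _ hv => (h v hv).trans (by
    conv_lhs => rw [← mul_one (ENNReal.ofReal K)]
    gcongr
    exact le_add_self)⟩

/-- **Fixed interval case.** Two points `wa < wb` of the closed fibre over `v₀`, and either `n = 0`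
or the closed fibre over `v₀` at height `≥ 2L > 0`: the column bound holds. -/
theorem colBound_of_fixed (hbd : Bornology.IsBounded (Om3 g)) {R : ℝ} (hR0 : 0 < R)
    (hR : ∀ p ∈ Om3 g, |p.2| < R) (hi : i < N) {wa wb : ℝ}
    (hwa : ((v₀, wa) : (Fin 2 → ℝ) × ℝ) ∈ closure (Om3 g))
    (hwb : ((v₀, wb) : (Fin 2 → ℝ) × ℝ) ∈ closure (Om3 g)) (hab : wa < wb) {L : ℝ} (hL : 0 < L)
    (haway : n ≠ 0 → ∀ w : ℝ, ((v₀, w) : (Fin 2 → ℝ) × ℝ) ∈ closure (Om3 g) → 2 * L ≤ w) :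
    ∃ δ > 0, ∃ C : ℝ≥0∞, C ≠ ∞ ∧ ∀ v : Fin 2 → ℝ, v ≠ v₀ → ‖v - v₀‖ < δ →
      FI κ μ e q n (Om3 g) i v ≤ C * (FF κ μ e N q n (Om3 g) v + ENNReal.ofReal ‖v - v₀‖⁻¹ + 1) := by
  -- the fixed interval inside all nearby fibres
  set a₀ := wa + (wb - wa) / 3 with ha₀
  set b₀ := wb - (wb - wa) / 3 with hb₀
  have hab₀ : a₀ < b₀ := by rw [ha₀, hb₀]; linarith
  obtain ⟨δ₁, hδ₁, hcol⟩ := column_interval g hwa hwb (a₀ := a₀) (b₀ := b₀) (by rw [ha₀]; linarith)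
    hab₀.le (by rw [hb₀]; linarith)
  have hRcl : ∀ p ∈ closure (Om3 g), |p.2| ≤ R := fun p hp =>
    closure_minimal (fun q (hq : q ∈ Om3 g) => (hR q hq).le)
      (isClosed_le (continuous_abs.comp continuous_snd) continuous_const) hp
  -- the lower height `L'`
  set L' : ℝ := if n = 0 then R else L with hL'
  have hL'0 : 0 < L' := by rw [hL']; split_ifs; exacts [hR0, hL]
  have hL'R : L' ≤ R := by
    rw [hL']; split_ifs with hn
    · exact le_rfl
    · have h1 := haway hn wa hwa
      have h2 := hRcl _ hwa
      simp only at h2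
      linarith [le_abs_self wa]
  obtain ⟨C, hC, hfix⟩ := fixed_fibre N n hab₀ hL'0 hL'R
  -- the gap below height `L` when `n ≠ 0`
  obtain ⟨δ₂, hδ₂, hgap⟩ : ∃ δ₂ > 0, ∀ p ∈ closure (Om3 g), p.2 ≤ L → n ≠ 0 → δ₂ ≤ ‖p.1 - v₀‖ := by
    by_cases hn : n = 0
    · exact ⟨1, one_pos, fun p _ _ hn' => absurd hn hn'⟩
    · obtain ⟨δ₂, hδ₂, hg⟩ := exists_gap hbd.isCompact_closure (isClosed_Iic (a := L)) v₀
        (fun w hw hmem => by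
          have := haway hn w hmem
          simp only [mem_Iic] at hw
          linarith)
      exact ⟨δ₂, hδ₂, fun p hp hpL _ => hg p hp hpL⟩
  refine colBound_of_FF g κ μ e N q n i v₀ (lt_min hδ₁ hδ₂) hC fun v hv => ?_
  rcases (fib (Om3 g) v).eq_empty_or_nonempty with hemp | ⟨w₁, hw₁⟩
  · rw [FI_eq_zero_of_empty κ μ e q n i hemp]; exact zero_le
  · refine FI_le_of_fibre κ μ e N q n (hfix (fun j => Qv q j v) _ (measurableSet_fib (measurableSet_Om3 g) v)
      (fun w hw => hcol (v, w₁) hw₁ (hv.trans_le (min_le_left _ _)) w hw) (fun w hw => ⟨(hR (v, w) hw).le,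
      fun hn => ?_⟩) i hi)
    rw [hL', if_neg hn]
    by_contra hlt
    push Not at hlt
    have := hgap (v, w) (subset_closure hw) hlt.le hn
    simp only at this
    linarith [hv.trans_le (min_le_right δ₁ δ₂)]

/-- **Touching case.** `n ≠ 0`, the cell above the pole plane, and the closed fibre over `v₀`
contains `0` and some `wb > 0`: the nearby fibres are thick and the column bound holds. -/
theorem colBound_of_touch (hpos : ∀ p ∈ Om3 g, 0 < p.2) {R : ℝ} (hR : ∀ p ∈ Om3 g, |p.2| < R)
    (hi : i < N) (h0 : ((v₀, 0) : (Fin 2 → ℝ) × ℝ) ∈ closure (Om3 g)) {wb : ℝ}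
    (hwb : ((v₀, wb) : (Fin 2 → ℝ) × ℝ) ∈ closure (Om3 g)) (hwb0 : 0 < wb) :
    ∃ δ > 0, ∃ C : ℝ≥0∞, C ≠ ∞ ∧ ∀ v : Fin 2 → ℝ, v ≠ v₀ → ‖v - v₀‖ < δ →
      FI κ μ e q n (Om3 g) i v ≤ C * (FF κ μ e N q n (Om3 g) v + ENNReal.ofReal ‖v - v₀‖⁻¹ + 1) := by
  obtain ⟨δ, hδ, hcol⟩ := column_interval g h0 hwb (a₀ := wb / 3) (b₀ := 2 * wb / 3) (by linarith)
    (by linarith) (by linarith)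
  obtain ⟨C, hC, hbrick⟩ := brick N n one_half_pos one_half_lt_one
  refine colBound_of_FF g κ μ e N q n i v₀ hδ hC fun v hv => ?_
  rcases (fib (Om3 g) v).eq_empty_or_nonempty with hemp | hne
  · rw [FI_eq_zero_of_empty κ μ e q n i hemp]; exact zero_le
  · obtain ⟨w₁, hw₁⟩ := id hne
    set S := fib (Om3 g) v with hS
    have hsub : Icc (wb / 3) (2 * wb / 3) ⊆ S := fun w hw => hcol (v, w₁) hw₁ hv w hw
    have hbb : BddBelow S := ⟨0, fun w hw => (hpos (v, w) hw).le⟩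
    have hba : BddAbove S := ⟨R, fun w hw => ((le_abs_self w).trans (hR (v, w) hw).le)⟩
    have hSeq : S = Ioo (sInf S) (sSup S) :=
      eq_Ioo_of_isOpen_convex (isOpen_fib (isOpen_Om3 g) v) (convex_fib (convex_Om3 g) v) hbb hba hne
    have hlo0 : 0 ≤ sInf S := le_csInf hne fun w hw => (hpos (v, w) hw).le
    have hlo : sInf S ≤ wb / 3 := csInf_le hbb (hsub ⟨le_rfl, by linarith⟩)
    have hhi : 2 * wb / 3 ≤ sSup S := le_csSup hba (hsub ⟨by linarith, le_rfl⟩)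
    refine FI_le_of_fibre κ μ e N q n ?_
    rw [← hS, hSeq]
    exact hbrick (fun j => Qv q j v) _ _ hlo0 (by linarith) i hi

end ColumnN

end SepThree

/-- **The column bound when the closed fibre touches the pole plane** (registered part of
`stub_separateThreeZero`; literal form of `SepThree.colBound_of_touch`): with `n ≠ 0` normalised so
that the open cell `Ω` lies above the pole plane, `|w| < R` on `Ω`, if the closure of `Ω` contains
`(v₀, 0)` and `(v₀, wb)` with `wb > 0`, then the fibre integrals `FI i v` of the `i`-th absolute
Taylor piece over the base points `v` near `v₀` are at most `C · (FF v + ‖v − v₀‖⁻¹ + 1)`. -/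
theorem separateThree_columnN {J m : ℕ} (g : Fin J → (Fin 2 → ℝ) × ℝ × ℝ) (κ : Fin m → Fin 2 → ℝ) (μ : Fin m → ℝ) (e : Fin m → ℕ) (N : ℕ) (q : ℕ → MvPolynomial (Fin 2) ℝ) (n : ℕ) (i : ℕ) (v₀ : Fin 2 → ℝ) (hpos : ∀ p ∈ SepThree.Om3 g, 0 < p.2) {R : ℝ} (hR : ∀ p ∈ SepThree.Om3 g, |p.2| < R) (hi : i < N) (h0 : ((v₀, 0) : (Fin 2 → ℝ) × ℝ) ∈ closure (SepThree.Om3 g)) {wb : ℝ} (hwb : ((v₀, wb) : (Fin 2 → ℝ) × ℝ) ∈ closure (SepThree.Om3 g)) (hwb0 : 0 < wb) : ∃ δ > 0, ∃ C : ENNReal, C ≠ ⊤ ∧ ∀ v : Fin 2 → ℝ, v ≠ v₀ → ‖v - v₀‖ < δ → SepThree.FI κ μ e q n (SepThree.Om3 g) i v ≤ C * (SepThree.FF κ μ e N q n (SepThree.Om3 g) v + ENNReal.ofReal ‖v - v₀‖⁻¹ + 1) := by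
  exact SepThree.colBound_of_touch g κ μ e N q n i v₀ hpos hR hi h0 hwb hwb0

end Summit.KontsevichZagierPeriods.ArrangementNormalForm.JanusBands
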